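import Literature.Combinatorics.SimpleGraph.HamiltonianPathSwap
import Mathlib.Data.Set.Card
import HarnessLib

/-!
# Three-port vertex gadgets in Hamiltonian-path counts, II: traversals ↔ (strand, base path)

Continuation of `HamiltonianPortGadget.lean` and `HamiltonianPathSwap.lean` (local replacement,
Garey–Johnson 1979, §3.2.2, three-port vertex gadget `h : PortGadget G' V VT x y z a b c M τ`).
For an ORIENTED pair of ports `(u, v)`:

* `h.travA s t R F u v` — the constrained Hamiltonian `s`–`t` paths of the big graph `G'` that
  enter the gadget at `u` (step `u, nb u`) and leave it at `v` (step `nb v, v`);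
* `h.travC s t R F u v` — the constrained Hamiltonian `s`–`t` paths of the base graph `M` passing
  `u, τ, v` in this order;
* `h.Admissible e`, `h.contractEdge e` — the constraint edges allowed on the `G'` side (edges
  inside the host, or PORT EDGES `p – nb p`) and their translation to the base graph (a gadget
  end point becomes `τ`; a port edge `p – nb p` becomes the star edge `p – τ`): required /
  forbidden port edges are exactly what iterated contraction of several mutually adjacent
  gadgets produces (the Tutte copies of an XOR-gadget are joined to each other);
* **`PortGadget.ncard_travA`**: `|travA u v| = hamCount G' VT (nb u) (nb v) · |travC u v|` — a
  traversal is a base path with a Hamiltonian path of the gadget from `nb u` to `nb v` spliced in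
  place of `τ` (`splice_mem_travA`, `exists_splice_eq`, `splice_injOn`); the constraints `R, F`
  of `travA` are admissible edges, those of `travC` their translations.

The hypotheses `b ∈ VT`, `c ∈ VT` (not recorded in `PortGadget`, which only needs `a ∈ VT` for
its structural half) are taken explicitly where the gadget neighbours of all three ports matter.
The partition over the six oriented pairs and the counting identity are in
`HamiltonianPortGadgetCount.lean`.

## References

* M. R. Garey, D. S. Johnson, *Computers and Intractability*, Freeman 1979, §3.2.2.
* M. Liśkiewicz, M. Ogihara, S. Toda, TCS 304 (2003) 129–156, §3 (Tutte gadget in the XOR-gadget).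
-/

namespace Literature.Combinatorics.SimpleGraph

variable {α : Type*} [DecidableEq α]

/-! ### Pairs across the seams of a three-block list -/

omit [DecidableEq α] in
/-- **Where a host–middle pair can sit**: in `P ++ m ++ S` with `q` in neither outer block and
`p` not in the middle block `m ≠ []`, the pair `{p, q}` is consecutive iff it is one of the two
seams.
[folklore] -/
theorem uses_seam_iff {P S m : List α} {p q : α} (hm : m ≠ []) (hp : p ∉ m)
    (hqP : q ∉ P) (hqS : q ∉ S) :
    Uses (P ++ m ++ S) (p, q) ↔
      (P.getLast? = some p ∧ m.head? = some q) ∨ (m.getLast? = some q ∧ S.head? = some p) := by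
  unfold Uses
  simp only
  rw [List.append_assoc, pair_infix_append_iff, pair_infix_append_iff,
    ← List.append_assoc, pair_infix_append_iff, pair_infix_append_iff,
    List.head?_append_of_ne_nil _ hm, List.getLast?_append_of_ne_nil _ hm]
  have n1 : ¬ [p, q] <:+: P := fun h' => hqP (mem_of_pair_infix h').2
  have n2 : ¬ [p, q] <:+: m := fun h' => hp (mem_of_pair_infix h').1
  have n3 : ¬ [p, q] <:+: S := fun h' => hqS (mem_of_pair_infix h').2
  have n4 : ¬ (m.getLast? = some p ∧ S.head? = some q) := fun h' => hp (List.mem_of_getLast? h'.1)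
  have n5 : ¬ [q, p] <:+: P := fun h' => hqP (mem_of_pair_infix h').1
  have n6 : ¬ [q, p] <:+: m := fun h' => hp (mem_of_pair_infix h').2
  have n7 : ¬ (P.getLast? = some q ∧ m.head? = some p) := fun h' => hqP (List.mem_of_getLast? h'.1)
  have n8 : ¬ [q, p] <:+: S := fun h' => hqS (mem_of_pair_infix h').1
  tauto

namespace PortGadget

variable {G' M : _root_.SimpleGraph α} {V VT : Finset α} {x y z a b c τ : α}
  (h : PortGadget G' V VT x y z a b c M τ)
include h

/-- **Traversals entering at `u` and leaving at `v`.** [cite: GareyJohnson1979, §3.2.2] -/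
def travA (s t : α) (R F : Finset (α × α)) (u v : α) : Set (List α) :=
  {l' | l' ∈ hamSetRF G' (V ∪ VT) s t R F ∧ [u, h.nb u] <:+: l' ∧ [h.nb v, v] <:+: l'}

/-- **Base paths through `u, τ, v` in this order.** [cite: GareyJohnson1979, §3.2.2] -/
def travC (_ : PortGadget G' V VT x y z a b c M τ) (s t : α) (R F : Finset (α × α)) (u v : α) :
    Set (List α) :=
  {l | l ∈ hamSetRF M (insert τ V) s t R F ∧ [u, τ, v] <:+: l}

variable {s t : α} {R F : Finset (α × α)}

/-- The gadget neighbour of a port is a gadget vertex (given `b, c ∈ VT`). [folklore] -/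
theorem nb_mem (hbT : b ∈ VT) (hcT : c ∈ VT) {u : α} (hu : h.IsPort u) : h.nb u ∈ VT := by
  rcases hu with rfl | rfl | rfl
  · rw [h.nb_x]; exact h.a_mem
  · rw [h.nb_y]; exact hbT
  · rw [h.nb_z]; exact hcT

/-- The port edge at a port. [folklore] -/
theorem adj_nb (hbT : b ∈ VT) (hcT : c ∈ VT) {u : α} (hu : h.IsPort u) : G'.Adj u (h.nb u) :=
  (h.adj_cross_iff hu.mem (h.nb_mem hbT hcT hu)).2 ⟨hu, rfl⟩

/-! ### Admissible constraint edges and their translation to the base graph -/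

/-- **Admissible constraint edges** on the side of `G'`: edges inside the host `V`, or port
edges `p – nb p` (in either orientation). [cite: GareyJohnson1979, §3.2.2] -/
def Admissible (e : α × α) : Prop :=
  (e.1 ∈ V ∧ e.2 ∈ V) ∨ ∃ p, h.IsPort p ∧ (e = (p, h.nb p) ∨ e = (h.nb p, p))

/-- Contraction of a vertex: gadget vertices become `τ`. [cite: GareyJohnson1979, §3.2.2] -/
def contractV (_ : PortGadget G' V VT x y z a b c M τ) (v : α) : α :=
  if v ∈ VT then τ else v

/-- **Translation of a constraint edge to the base graph**: end points in the gadget become `τ`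
(so a port edge `p – nb p` becomes the star edge `p – τ`, host edges are unchanged).
[cite: GareyJohnson1979, §3.2.2] -/
def contractEdge (e : α × α) : α × α :=
  (h.contractV e.1, h.contractV e.2)

/-- Host vertices are not contracted. [folklore] -/
theorem contractV_of_mem {v : α} (hv : v ∈ V) : h.contractV v = v := by
  simp [contractV, h.not_mem_VT hv]

/-- Gadget vertices are contracted to `τ`. [folklore] -/
theorem contractV_of_mem_VT {v : α} (hv : v ∈ VT) : h.contractV v = τ := by
  simp [contractV, hv]

/-- Host edges are unchanged by the translation. [folklore] -/
theorem contractEdge_of_mem {e : α × α} (he : e.1 ∈ V ∧ e.2 ∈ V) : h.contractEdge e = e := by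
  unfold contractEdge
  rw [h.contractV_of_mem he.1, h.contractV_of_mem he.2]

/-- **Constraints carry over along a splice**: for the traversal `P ++ w ++ S` (outer blocks in
the host ending at the port `u` and starting at the port `v`, `w` a Hamiltonian path of the
gadget from `nb u` to `nb v`) and the base path `P ++ [τ] ++ S`, an admissible edge is used by
the former iff its translation is used by the latter. [cite: GareyJohnson1979, §3.2.2] -/
theorem uses_splice_iff (hbT : b ∈ VT) (hcT : c ∈ VT) {P S w : List α} {u v : α}
    (hP : ∀ d ∈ P, d ∈ V) (hS : ∀ d ∈ S, d ∈ V) (hPu : P.getLast? = some u) (hSv : S.head? = some v)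
    (hw : IsHamPathOn G' VT (h.nb u) (h.nb v) w)
    {e : α × α} (he : h.Admissible e) :
    Uses (P ++ w ++ S) e ↔ Uses (P ++ [τ] ++ S) (h.contractEdge e) := by
  have hwV : ∀ d ∈ w, d ∉ V := fun d hd => h.not_mem_V (hw.mem_iff.1 hd)
  have hτ : ∀ d ∈ [τ], d ∉ V := by simpa using h.τ_not_mem
  rcases he with he | ⟨p, hp, he⟩
  · rw [h.contractEdge_of_mem he]
    exact uses_swap_iff (P := P) (S := S) hτ hwV (List.cons_ne_nil _ _) hw.ne_nil he
  · -- a port edge `p – nb p`: used iff `p` is the entry or the exit port, on both sides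
    have hpV : p ∈ V := hp.mem
    have hnT : h.nb p ∈ VT := h.nb_mem hbT hcT hp
    have hce : h.contractEdge (p, h.nb p) = (p, τ) := by
      unfold contractEdge; rw [h.contractV_of_mem hpV, h.contractV_of_mem_VT hnT]
    have hce' : h.contractEdge (h.nb p, p) = (τ, p) := by
      unfold contractEdge; rw [h.contractV_of_mem hpV, h.contractV_of_mem_VT hnT]
    have hpw : p ∉ w := fun hm => hwV p hm hpV
    have hnP : h.nb p ∉ P := fun hm => h.not_mem_V hnT (hP _ hm)
    have hnS : h.nb p ∉ S := fun hm => h.not_mem_V hnT (hS _ hm)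
    have hτP : τ ∉ P := fun hm => h.τ_not_mem (hP _ hm)
    have hτS : τ ∉ S := fun hm => h.τ_not_mem (hS _ hm)
    have hpτ : p ≠ τ := fun hpt => h.τ_not_mem (hpt ▸ hpV)
    have key1 : Uses (P ++ w ++ S) (p, h.nb p) ↔ u = p ∨ v = p := by
      rw [uses_seam_iff hw.ne_nil hpw hnP hnS, hPu, hSv, hw.2.2.1, hw.2.2.2.1]
      simp only [Option.some.injEq]
      constructor
      · rintro (⟨rfl, -⟩ | ⟨-, rfl⟩)
        exacts [Or.inl rfl, Or.inr rfl]
      · rintro (rfl | rfl)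
        exacts [Or.inl ⟨rfl, rfl⟩, Or.inr ⟨rfl, rfl⟩]
    have key2 : Uses (P ++ [τ] ++ S) (p, τ) ↔ u = p ∨ v = p := by
      rw [uses_seam_iff (List.cons_ne_nil τ []) (by simpa using hpτ) hτP hτS, hPu, hSv]
      simp only [List.head?_cons, List.getLast?_singleton, Option.some.injEq, and_true, true_and]
    rcases he with rfl | rfl
    · rw [hce, key1, key2]
    · rw [hce', uses_swap, key1, uses_swap, key2]

/-! ### The entry and exit ports of a traversal are determined -/

/-- In the decomposition of `decomp`, the entry step is `u₀, nb u₀`: a port `u` with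
`[u, nb u] <:+: l'` is `u₀`. [folklore] -/
theorem entry_port_eq (hbT : b ∈ VT) (hcT : c ∈ VT) {l₁ l₂ xs : List α} {u₀ v₀ u : α}
    (hu₀ : h.IsPort u₀) (hv₀ : h.IsPort v₀) (hxs : IsHamPathOn G' VT (h.nb u₀) (h.nb v₀) xs)
    (hl₁ : ∀ d ∈ l₁, d ∈ V) (hl₂ : ∀ d ∈ l₂, d ∈ V) (hu : h.IsPort u)
    (hinf : [u, h.nb u] <:+: l₁ ++ u₀ :: (xs ++ v₀ :: l₂)) : u = u₀ :=
  (entry_eq (VX := VT) (fun d hd => h.not_mem_VT (hl₁ d hd)) (fun d hd => h.not_mem_VT (hl₂ d hd))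
    (h.not_mem_VT hu₀.mem) (h.not_mem_VT hv₀.mem) (fun _ hd => hxs.mem_iff.1 hd)
    (h.not_mem_VT hu.mem) (h.nb_mem hbT hcT hu) hinf).1

/-- The exit step is `nb v₀, v₀`: a port `v` with `[nb v, v] <:+: l'` is `v₀`. [folklore] -/
theorem exit_port_eq (hbT : b ∈ VT) (hcT : c ∈ VT) {l₁ l₂ xs : List α} {u₀ v₀ v : α}
    (hu₀ : h.IsPort u₀) (hv₀ : h.IsPort v₀) (hxs : IsHamPathOn G' VT (h.nb u₀) (h.nb v₀) xs)
    (hl₁ : ∀ d ∈ l₁, d ∈ V) (hl₂ : ∀ d ∈ l₂, d ∈ V) (hv : h.IsPort v)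
    (hinf : [h.nb v, v] <:+: l₁ ++ u₀ :: (xs ++ v₀ :: l₂)) : v = v₀ :=
  (exit_eq (VX := VT) (fun d hd => h.not_mem_VT (hl₁ d hd)) (fun d hd => h.not_mem_VT (hl₂ d hd))
    (h.not_mem_VT hu₀.mem) (h.not_mem_VT hv₀.mem) (fun _ hd => hxs.mem_iff.1 hd)
    (h.not_mem_VT hv.mem) (h.nb_mem hbT hcT hv) hinf).1

/-! ### Splicing a gadget path into a base path gives a traversal -/

/-- A base path through `u, τ, v` splits as `(L ++ [u]) ++ [τ] ++ (v :: R')` with the outer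
blocks inside `V`. [folklore] -/
theorem travC_split {u v : α} {l : List α} (hl : l ∈ h.travC s t R F u v) :
    ∃ L R', l = (L ++ [u]) ++ [τ] ++ (v :: R') ∧ (∀ d ∈ L ++ [u], d ∈ V) ∧ (∀ d ∈ v :: R', d ∈ V) := by
  obtain ⟨⟨hl, -, -⟩, L, R', hlw⟩ := hl
  have hshape : l = (L ++ [u]) ++ [τ] ++ (v :: R') := by rw [← hlw]; simp
  have hnd : l.Nodup := hl.1
  rw [hshape, List.nodup_append', List.nodup_append'] at hnd
  have hV : ∀ d ∈ l, d ≠ τ → d ∈ V := fun d hd hne => by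
    have := hl.mem_iff.1 hd
    rcases Finset.mem_insert.1 this with h' | h'
    exacts [absurd h' hne, h']
  have hmemP : ∀ d ∈ L ++ [u], d ∈ l := fun d hd => by
    rw [hshape]; simp only [List.mem_append, List.mem_cons] at hd ⊢; tauto
  have hmemS : ∀ d ∈ v :: R', d ∈ l := fun d hd => by
    rw [hshape]; simp only [List.mem_append, List.mem_cons] at hd ⊢; tauto
  refine ⟨L, R', hshape, fun d hd => hV d (hmemP d hd) fun hdτ => ?_,
    fun d hd => hV d (hmemS d hd) fun hdτ => ?_⟩
  · exact hnd.1.2.2 hd (by simp [hdτ])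
  · exact hnd.2.2 (by simp [hdτ]) hd

/-- **Splicing gives a traversal**: a Hamiltonian path `w` of `G'` through `VT` from `nb u` to
`nb v` spliced into a base path through `u, τ, v` in place of `τ` is a traversal entering at `u`
and leaving at `v`, with the same constraints. [cite: GareyJohnson1979, §3.2.2] -/
theorem splice_mem_travA (hbT : b ∈ VT) (hcT : c ∈ VT) (hR : ∀ e ∈ R, h.Admissible e)
    (hF : ∀ e ∈ F, h.Admissible e) {u v : α} (hu : h.IsPort u) (hv : h.IsPort v)
    {w l : List α} (hw : IsHamPathOn G' VT (h.nb u) (h.nb v) w)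
    (hl : l ∈ h.travC s t (R.image h.contractEdge) (F.image h.contractEdge) u v) :
    splice τ w l ∈ h.travA s t R F u v := by
  obtain ⟨L, R', hshape, hP, hS⟩ := h.travC_split hl
  obtain ⟨⟨hl, hlR, hlF⟩, -⟩ := hl
  have hsV : s ∈ V := by
    have hh := hl.2.2.1
    rw [hshape, List.append_assoc, List.head?_append_of_ne_nil _ (by simp)] at hh
    exact hP s (List.mem_of_mem_head? hh)
  have htV : t ∈ V := hS t (by
    have := hl.2.2.2.1
    rw [hshape, List.getLast?_append_of_ne_nil _ (List.cons_ne_nil v R')] at this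
    exact List.mem_of_getLast? this)
  have hτP : τ ∉ L ++ [u] := fun hm => h.τ_not_mem (hP τ hm)
  have hτS : τ ∉ v :: R' := fun hm => h.τ_not_mem (hS τ hm)
  have hsplice : splice τ w l = (L ++ [u]) ++ w ++ (v :: R') := by
    rw [hshape, List.append_assoc (L ++ [u]) [τ], List.singleton_append, splice_eq τ w hτP hτS]
  have hwne : w ≠ [] := hw.ne_nil
  have hwV : ∀ d ∈ w, d ∉ V := fun d hd => h.not_mem_V (hw.mem_iff.1 hd)
  rw [hshape] at hl hlR hlF
  have hswap := isHamPathOn_swap (G₁ := M) (G₂ := G') (V := V) (m₁ := [τ]) (m₂ := w) h.base hP hS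
    (by simpa using h.τ_not_mem) hwV (List.cons_ne_nil _ _) hwne hw.1 hw.2.2.2.2
    (fun p hp q hq => by
      rw [List.getLast?_append, List.getLast?_singleton] at hp
      simp only [Option.mem_def, Option.some_or, Option.some.injEq] at hp
      rw [hw.2.2.1] at hq
      simp only [Option.mem_def, Option.some.injEq] at hq
      subst hp; subst hq
      exact h.adj_nb hbT hcT hu)
    (fun p hp q hq => by
      rw [hw.2.2.2.1] at hp
      simp only [Option.mem_def, Option.some.injEq, List.head?_cons] at hp hq
      subst hp; subst hq
      exact (h.adj_nb hbT hcT hv).symm)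
    hl hsV htV
  have hV : ((L ++ [u]) ++ (v :: R')).toFinset = V :=
    toFinset_outer_eq (G₁ := M) (X := {τ}) (m₁ := [τ]) hP hS
      (Finset.disjoint_singleton_right.2 h.τ_not_mem) (by ext d; simp) (by rwa [Finset.union_comm, ← Finset.insert_eq])
  rw [hV, hw.2.1] at hswap
  rw [hsplice]
  have hPu : (L ++ [u]).getLast? = some u := by simp
  have hSv : (v :: R').head? = some v := rfl
  refine ⟨⟨hswap, fun e he => ?_, fun e he => ?_⟩, ?_, ?_⟩
  · exact (h.uses_splice_iff hbT hcT hP hS hPu hSv hw (hR e he)).2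
      (hlR _ (Finset.mem_image_of_mem _ he))
  · exact fun hu' => hlF _ (Finset.mem_image_of_mem _ he)
      ((h.uses_splice_iff hbT hcT hP hS hPu hSv hw (hF e he)).1 hu')
  · obtain ⟨w', hw'⟩ : ∃ w', w = h.nb u :: w' := by
      rcases w with _ | ⟨d, w'⟩
      · exact absurd rfl hwne
      · have := hw.2.2.1
        simp only [List.head?_cons, Option.some.injEq] at this
        exact ⟨w', by rw [this]⟩
    exact ⟨L, w' ++ (v :: R'), by rw [hw']; simp⟩
  · obtain ⟨w', hw'⟩ := List.getLast?_eq_some_iff.1 hw.2.2.2.1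
    exact ⟨L ++ [u] ++ w', R', by rw [hw']; simp⟩

/-! ### Every traversal is a splice, in exactly one way -/

/-- **Every traversal is a splice**: for a traversal `l'` entering at `u` and leaving at `v`
there are a base path `l` through `u, τ, v` and a Hamiltonian path `w` of the gadget from `nb u`
to `nb v` with `splice τ w l = l'`. [cite: GareyJohnson1979, §3.2.2] -/
theorem exists_splice_eq (hbT : b ∈ VT) (hcT : c ∈ VT) (hsV : s ∈ V) (htV : t ∈ V)
    (hR : ∀ e ∈ R, h.Admissible e) (hF : ∀ e ∈ F, h.Admissible e)
    {u v : α} (hu : h.IsPort u) (hv : h.IsPort v) {l' : List α} (hl' : l' ∈ h.travA s t R F u v) :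
    ∃ w l, IsHamPathOn G' VT (h.nb u) (h.nb v) w ∧
      l ∈ h.travC s t (R.image h.contractEdge) (F.image h.contractEdge) u v ∧ splice τ w l = l' := by
  obtain ⟨⟨hl', hl'R, hl'F⟩, hin, hout⟩ := hl'
  obtain ⟨l₁, l₂, u₀, v₀, xs, hshape, hu₀, hv₀, -, hxs, hl₁, hl₂⟩ := h.decomp hsV htV hl'
  rw [hshape] at hin hout
  obtain rfl := h.entry_port_eq hbT hcT hu₀ hv₀ hxs hl₁ hl₂ hu hin
  obtain rfl := h.exit_port_eq hbT hcT hu₀ hv₀ hxs hl₁ hl₂ hv hout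
  have hP : ∀ d ∈ l₁ ++ [u], d ∈ V := fun d hd => by
    rcases List.mem_append.1 hd with hd | hd
    · exact hl₁ d hd
    · simp only [List.mem_singleton] at hd; exact hd ▸ hu.mem
  have hS : ∀ d ∈ v :: l₂, d ∈ V := fun d hd => by
    rcases List.mem_cons.1 hd with rfl | hd
    exacts [hv.mem, hl₂ d hd]
  have hshape' : l' = (l₁ ++ [u]) ++ xs ++ (v :: l₂) := by rw [hshape]; simp
  have hxsV : ∀ d ∈ xs, d ∉ V := fun d hd => h.not_mem_V (hxs.mem_iff.1 hd)
  have hxsne : xs ≠ [] := hxs.ne_nil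
  rw [hshape'] at hl' hl'R hl'F
  have hagree : ∀ p ∈ V, ∀ q ∈ V, (G'.Adj p q ↔ M.Adj p q) := fun p hp q hq => (h.base p hp q hq).symm
  have hswap := isHamPathOn_swap (G₁ := G') (G₂ := M) (V := V) (m₁ := xs) (m₂ := [τ]) hagree hP hS
    hxsV (by simpa using h.τ_not_mem) hxsne (List.cons_ne_nil _ _) (List.nodup_singleton τ)
    (List.isChain_singleton τ)
    (fun p hp q hq => by
      rw [List.getLast?_append, List.getLast?_singleton] at hp
      simp only [Option.mem_def, Option.some_or, Option.some.injEq, List.head?_cons] at hp hq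
      subst hp; subst hq
      exact (h.adj_τ hu).symm)
    (fun p hp q hq => by
      simp only [List.getLast?_singleton, Option.mem_def, Option.some.injEq, List.head?_cons] at hp hq
      subst hp; subst hq
      exact h.adj_τ hv)
    hl' hsV htV
  have hV : ((l₁ ++ [u]) ++ (v :: l₂)).toFinset = V :=
    toFinset_outer_eq (G₁ := G') (X := VT) hP hS h.disjoint hxs.2.1 hl'
  rw [hV] at hswap
  have hW : V ∪ ([τ] : List α).toFinset = insert τ V := by
    rw [Finset.insert_eq, Finset.union_comm]; simp
  rw [hW] at hswap
  have hPu : (l₁ ++ [u]).getLast? = some u := by simp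
  have hSv : (v :: l₂).head? = some v := rfl
  refine ⟨xs, (l₁ ++ [u]) ++ [τ] ++ (v :: l₂), hxs, ⟨⟨hswap, fun e' he' => ?_, fun e' he' => ?_⟩, ?_⟩, ?_⟩
  · obtain ⟨e, he, rfl⟩ := Finset.mem_image.1 he'
    exact (h.uses_splice_iff hbT hcT hP hS hPu hSv hxs (hR e he)).1 (hl'R e he)
  · obtain ⟨e, he, rfl⟩ := Finset.mem_image.1 he'
    exact fun hu' => hl'F e he ((h.uses_splice_iff hbT hcT hP hS hPu hSv hxs (hF e he)).2 hu')
  · exact ⟨l₁, l₂, by simp⟩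
  · have hτP : τ ∉ l₁ ++ [u] := fun hm => h.τ_not_mem (hP τ hm)
    have hτS : τ ∉ v :: l₂ := fun hm => h.τ_not_mem (hS τ hm)
    rw [List.append_assoc (l₁ ++ [u]) [τ], List.singleton_append, splice_eq τ xs hτP hτS, hshape']

/-- **The splice determines its parts** (the base path and the gadget path are read off the
traversal as the blocks outside and inside `VT`). [folklore] -/
theorem splice_injOn {u v : α} (hv : h.IsPort v)
    {w₁ w₂ l₁ l₂ : List α} (hw₁ : IsHamPathOn G' VT (h.nb u) (h.nb v) w₁)
    (hw₂ : IsHamPathOn G' VT (h.nb u) (h.nb v) w₂) (hl₁ : l₁ ∈ h.travC s t R F u v)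
    (hl₂ : l₂ ∈ h.travC s t R F u v) (heq : splice τ w₁ l₁ = splice τ w₂ l₂) :
    w₁ = w₂ ∧ l₁ = l₂ := by
  obtain ⟨L₁, R₁, hs₁, hP₁, hS₁⟩ := h.travC_split hl₁
  obtain ⟨L₂, R₂, hs₂, hP₂, hS₂⟩ := h.travC_split hl₂
  have key : ∀ {L R' w : List α}, (∀ d ∈ L ++ [u], d ∈ V) → (∀ d ∈ v :: R', d ∈ V) →
      IsHamPathOn G' VT (h.nb u) (h.nb v) w →
      splice τ w ((L ++ [u]) ++ [τ] ++ (v :: R')) = (L ++ [u]) ++ w ++ (v :: R') ∧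
        ((L ++ [u]) ++ w ++ (v :: R')).takeWhile (fun d => decide (d ∉ VT)) = L ++ [u] ∧
        (w ++ (v :: R')).takeWhile (fun d => decide (d ∈ VT)) = w := by
    intro L R' w hP hS hw
    have hτP : τ ∉ L ++ [u] := fun hm => h.τ_not_mem (hP τ hm)
    have hτS : τ ∉ v :: R' := fun hm => h.τ_not_mem (hS τ hm)
    obtain ⟨d, w', hw'⟩ : ∃ d w', w = d :: w' := List.exists_cons_of_ne_nil hw.ne_nil
    have hd : d ∈ VT := hw.mem_iff.1 (by rw [hw']; exact List.mem_cons_self)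
    refine ⟨by rw [List.append_assoc (L ++ [u]) [τ], List.singleton_append, splice_eq τ w hτP hτS],
      ?_, ?_⟩
    · rw [List.append_assoc, List.takeWhile_append_of_pos (fun e he => by simpa using h.not_mem_VT (hP e he)),
        hw', List.cons_append, List.takeWhile_cons_of_neg (by simpa using hd), List.append_nil]
    · rw [List.takeWhile_append_of_pos (fun e he => by simpa using hw.mem_iff.1 he),
        List.takeWhile_cons_of_neg (by simpa using h.not_mem_VT hv.mem), List.append_nil]
  obtain ⟨he₁, ht₁, hw₁'⟩ := key hP₁ hS₁ hw₁
  obtain ⟨he₂, ht₂, hw₂'⟩ := key hP₂ hS₂ hw₂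
  rw [hs₁, hs₂, he₁, he₂] at heq
  have hL : L₁ ++ [u] = L₂ ++ [u] := by rw [← ht₁, ← ht₂, heq]
  have hLL : L₁ = L₂ := List.append_cancel_right hL
  subst hLL
  simp only [List.append_assoc] at heq
  have hrest : w₁ ++ (v :: R₁) = w₂ ++ (v :: R₂) := by
    have := List.append_cancel_left heq
    simpa using this
  have hw : w₁ = w₂ := by rw [← hw₁', ← hw₂', hrest]
  subst hw
  have hR : v :: R₁ = v :: R₂ := List.append_cancel_left hrest
  refine ⟨rfl, ?_⟩
  rw [hs₁, hs₂, (List.cons.inj hR).2]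

/-- **Counting the traversals**: the traversals entering at `u` and leaving at `v` are in
bijection with pairs (Hamiltonian path of the gadget from `nb u` to `nb v`, base path through
`u, τ, v`), so `|travA u v| = hamCount G' VT (nb u) (nb v) · |travC u v|`.
[cite: GareyJohnson1979, §3.2.2 (local replacement)] -/
theorem ncard_travA (hbT : b ∈ VT) (hcT : c ∈ VT) (hsV : s ∈ V) (htV : t ∈ V)
    (hR : ∀ e ∈ R, h.Admissible e) (hF : ∀ e ∈ F, h.Admissible e)
    {u v : α} (hu : h.IsPort u) (hv : h.IsPort v) :
    (h.travA s t R F u v).ncard = hamCount G' VT (h.nb u) (h.nb v) *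
      (h.travC s t (R.image h.contractEdge) (F.image h.contractEdge) u v).ncard := by
  have hB : hamCount G' VT (h.nb u) (h.nb v) = {w | IsHamPathOn G' VT (h.nb u) (h.nb v) w}.ncard := by
    rw [hamCount_eq, hamCountRF]
    congr 1
    ext w
    exact mem_hamSetRF_empty
  rw [hB, ← Set.ncard_prod]
  symm
  refine Set.ncard_congr (fun (p : List α × List α) _ => splice τ p.1 p.2) (fun p hp => ?_)
    (fun p q hp hq hpq => ?_)
    (fun l' hl' => ?_)
  · exact h.splice_mem_travA hbT hcT hR hF hu hv (Set.mem_prod.1 hp).1 (Set.mem_prod.1 hp).2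
  · obtain ⟨hw, hl⟩ := h.splice_injOn hv (Set.mem_prod.1 hp).1 (Set.mem_prod.1 hq).1
      (Set.mem_prod.1 hp).2 (Set.mem_prod.1 hq).2 hpq
    exact Prod.ext hw hl
  · obtain ⟨w, l, hw, hl, heq⟩ := h.exists_splice_eq hbT hcT hsV htV hR hF hu hv hl'
    exact ⟨(w, l), Set.mem_prod.2 ⟨hw, hl⟩, heq⟩

end PortGadget

end Literature.Combinatorics.SimpleGraph
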